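import Literature.MathematicalPhysics.QuantumLattice.FermiRG.BGM2006Sec2TadpoleProof
import Literature.MathematicalPhysics.QuantumLattice.SectorDenomLineBounds
import Literature.Analysis.Calculus.LineRestrictionIteratedDeriv
import HarnessLib

/-!
# Benfatto–Giuliani–Mastropietro 2006, §2.4 (2.42): all-order derivative bounds for the scale-dependent
dispersion `E_h(k₀, ·)`, and their line-derivative form

Companion proof file of `BGM2006Sec2Setup.lean` (typer-wave file F1a of the cell `gate-hubbard-kl`; source
BGM06 = G. Benfatto, A. Giuliani, V. Mastropietro, *Fermi liquid behavior in the 2D Hubbard model at low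
temperatures*, Ann. Henri Poincaré **7** (2006) 809–898, arXiv:cond-mat/0507686; locators `p00NN:Lnn` =
chunk/line of the `lit read` render of the arXiv TeX).

BGM (2.42), p0009:L110–p0010:L1: "by proceeding as in the proof of Lemma 2.1, we see that (2.36) imply that
`|E_h(k) - E_0(k)| ≤ C₀'|U|`, `|∂_{k_i}(E_h - E_0)(k)| ≤ C₁'|U|²`,
`|∂_{k_{i₁}}∂_{k_{i₂}}(E_h - E_0)(k)| ≤ C₂'c₀²`,
`|∂_{k_{i₁}}⋯∂_{k_{i_n}}(E_h - E_0)(k)| ≤ C_n'|U|²|h|γ^{(2-n)h}`, `n ≥ 3`, with `c₀ = |h_β|U₀` small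
enough."  The orders `0, 1, 2` are in the tree (`BGM2006Sec2TadpoleProof.norm_E_sub_sqDispersion_le`,
`BGM2006Sec2Lemma21Proof.bgm_diff_bounds`, `bgmEffDisp_perturbation`); this file PROVES the statement at
EVERY order `n ≥ 1` for the spatial mixed partials at a Matsubara frequency (`norm_mixedPartial_E_sub_le`:
telescoping `E_h = E_0 - Σ_{j=h+1}^0 (E_j - E_{j-1})` and the `a = 0` clause of (2.36), with the elementary
sums `Σ_{m<|h|} mγ^{-m} ≤ 2`, `Σ_{m<|h|} mγ^{(n-2)m} ≤ h²γ^{(2-n)h}`), and the consequence used by the proofs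
of Lemmas 2.2/2.3 ((2.53), (2.55), (2.56)): **all-order bounds for the derivatives of `E_h(k₀, ·)` along a
line `s ↦ x⃗ + s w⃗`** (`norm_iteratedDeriv_slice_line_le`):
`‖∂ₛⁿ E_h(k₀, x⃗ + s w⃗)‖ ≤ [2 + C_n U²h²γ^{(2-n)h}]·|w⃗|₁ⁿ` for `n ≥ 2` and `≤ (2 + 2C₁U²)|w⃗|₁` for
`n = 1`, uniformly in `k₀ ∈ D_β`, `x⃗`, `s`, `β` — the moving dispersion has the derivatives of `ε₀` up to
order `2` and grows like `γ^{(2-n)h}` beyond (this growth is what limits the tangential gain in (2.55) to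
`O(γ^{-Nh})`).

Everything is proved; no definitions, no named facts, no `sorry`, no instances, no notation.

## Sources

* [BGM06] G. Benfatto, A. Giuliani, V. Mastropietro, Ann. Henri Poincaré 7 (2006) 809–898,
  arXiv:cond-mat/0507686, §2.3 (2.36), §2.4 (2.41a)–(2.42) p0009:L77–p0010:L1, §2.5 proof of Lemma 2.2
  (2.53)–(2.56) p0010:L129–p0011:L33. [BenfattoGiulianiMastropietro2006]
-/

noncomputable section

open Real Set Filter
open scoped Topology

namespace Literature.MathematicalPhysics.QuantumLattice.FermiRG

/-! ### §1 Multilinear evaluation on a constant tuple of `ℝ²` -/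

section Multilinear

variable {F : Type*} [NormedAddCommGroup F] [NormedSpace ℝ F]

/-- A vector of `ℝ²` through the coordinate vectors. [folklore] -/
private theorem eq_sum_smul_single (w : Fin 2 → ℝ) :
    w = ∑ l : Fin 2, w l • (Pi.single l (1 : ℝ) : Fin 2 → ℝ) := by
  ext i
  rw [Fin.sum_univ_two]
  fin_cases i <;> simp

/-- **Evaluation of an `n`-linear map on `(w⃗, …, w⃗)` through its components**: if every component
`‖f(e_{i₁}, …, e_{iₙ})‖ ≤ B` then `‖f(w⃗, …, w⃗)‖ ≤ B(|w₁| + |w₂|)ⁿ`. [folklore] -/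
private theorem norm_apply_const_le_of_components {b : ℕ}
    (f : ContinuousMultilinearMap ℝ (fun _ : Fin b => Fin 2 → ℝ) F) (w : Fin 2 → ℝ) {B : ℝ}
    (hB : ∀ i : Fin b → Fin 2, ‖f (fun j => Pi.single (i j) (1 : ℝ))‖ ≤ B) :
    ‖f (fun _ => w)‖ ≤ B * (|w 0| + |w 1|) ^ b := by
  classical
  have hB0 : 0 ≤ B := (norm_nonneg _).trans (hB (fun _ => 0))
  have hw : (fun _ : Fin b => w) = fun j : Fin b => ∑ l : Fin 2, (fun (_ : Fin b) (l : Fin 2) => w l • (Pi.single l (1 : ℝ) : Fin 2 → ℝ)) j l := by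
    funext j; exact eq_sum_smul_single w
  rw [hw, ContinuousMultilinearMap.map_sum]
  calc ‖∑ r : Fin b → Fin 2, f fun j => w (r j) • (Pi.single (r j) (1 : ℝ) : Fin 2 → ℝ)‖
      ≤ ∑ r : Fin b → Fin 2, ‖f fun j => w (r j) • (Pi.single (r j) (1 : ℝ) : Fin 2 → ℝ)‖ := norm_sum_le _ _
    _ ≤ ∑ r : Fin b → Fin 2, (∏ j, |w (r j)|) * B := by
        refine Finset.sum_le_sum fun r _ => ?_
        rw [ContinuousMultilinearMap.map_smul_univ, norm_smul, Real.norm_eq_abs, Finset.abs_prod]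
        exact mul_le_mul_of_nonneg_left (hB r) (Finset.prod_nonneg fun j _ => abs_nonneg _)
    _ = B * ∑ r : Fin b → Fin 2, ∏ j, |w (r j)| := by rw [Finset.mul_sum]; simp_rw [mul_comm]
    _ = B * (|w 0| + |w 1|) ^ b := by
        congr 1
        rw [show |w 0| + |w 1| = ∑ l : Fin 2, |w l| by simp [Fin.sum_univ_two], Fintype.sum_pow]

end Multilinear

/-! ### §2 (2.42): the mixed spatial partials of `E_h - E_0` at every order -/

section MixedPartials

variable {β U : ℝ} {C : ℕ → ℝ} {hβ : ℤ} {E : ℤ → ℝ × (Fin 2 → ℝ) → ℂ}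

/-- `bgmTimeDiffIter β 0 = id`. [folklore] -/
private theorem bgmTimeDiffIter_zero' (β : ℝ) (f : ℝ × (Fin 2 → ℝ) → ℂ) : bgmTimeDiffIter β 0 f = f := rfl

/-- **The inductive bound (2.36), `a = 0`, at scale `j = -m`**: for `b ≥ 1`,
`‖∂_{k_{i₁}}⋯∂_{k_{i_b}}(E_j - E_{j-1})(k₀, k⃗)‖ ≤ C_b U²|j|γ^{(2-b)j}`. [cite: BenfattoGiulianiMastropietro2006, §2.3 (2.36) p0008:L46] -/
theorem norm_mixedPartial_increment_le (hS : BGMSmoothness β U C hβ E) {m : ℕ} (hm : hβ ≤ -(m : ℤ))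
    {b : ℕ} (hb : 1 ≤ b) (i : Fin b → Fin 2) {k₀ : ℝ} (hk₀ : k₀ ∈ matsubaraSet β) (k : Fin 2 → ℝ) :
    ‖mixedPartial i (fun k => E (-(m : ℤ)) (k₀, k) - E (-(m : ℤ) - 1) (k₀, k)) k‖ ≤
      |C b| * U ^ 2 * ((m : ℝ) * (4 : ℝ) ^ ((2 - (b : ℤ)) * (-(m : ℤ)))) := by
  obtain ⟨-, -, hS3⟩ := hS
  obtain ⟨-, hbd⟩ := hS3 (-(m : ℤ)) hm (by omega)
  have h := hbd 0 b (by omega) i k₀ hk₀ k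
  have hcast : |(((-(m : ℤ)) : ℤ) : ℝ)| = m := by push_cast; rw [abs_neg, Nat.abs_cast]
  simp only [bgmTimeDiffIter_zero', zero_add, hcast] at h
  calc _ ≤ C b * |U| ^ 2 * m * (4 : ℝ) ^ ((2 - (b : ℤ)) * (-(m : ℤ))) := h
    _ = C b * (U ^ 2 * ((m : ℝ) * (4 : ℝ) ^ ((2 - (b : ℤ)) * (-(m : ℤ))))) := by rw [sq_abs]; ring
    _ ≤ |C b| * (U ^ 2 * ((m : ℝ) * (4 : ℝ) ^ ((2 - (b : ℤ)) * (-(m : ℤ))))) :=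
        mul_le_mul_of_nonneg_right (le_abs_self _) (by positivity)
    _ = _ := by ring

/-- **(2.42) at every order `b ≥ 1`, telescoped form**: for `h_β - 1 ≤ h' ≤ 0` and `k₀ ∈ D_β`,
`‖∂_{k_{i₁}}⋯∂_{k_{i_b}}(E_{h'} - E_0)(k₀, k⃗)‖ ≤ C_b U² Σ_{m<|h'|} mγ^{(b-2)m}` ("proceeding as in the proof of
Lemma 2.1", i.e. (2.41a) for all orders). [cite: BenfattoGiulianiMastropietro2006, §2.4 (2.42) p0009:L110–p0010:L1] -/
theorem norm_mixedPartial_E_sub_le_sum (hI : BGMInitial E) (hS : BGMSmoothness β U C hβ E) {h' : ℤ}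
    (hh₁ : hβ - 1 ≤ h') (hh₀ : h' ≤ 0) {b : ℕ} (hb : 1 ≤ b) (i : Fin b → Fin 2) {k₀ : ℝ}
    (hk₀ : k₀ ∈ matsubaraSet β) (k : Fin 2 → ℝ) :
    ‖mixedPartial i (fun k => E h' (k₀, k) - ((sqDispersion k : ℝ) : ℂ)) k‖ ≤
      |C b| * U ^ 2 * ∑ m ∈ Finset.range (-h').toNat, (m : ℝ) * (4 : ℝ) ^ ((2 - (b : ℤ)) * (-(m : ℤ))) := by
  have hS1 := hS.1
  set n := (-h').toNat with hn
  have hmem : ∀ m ∈ Finset.range n, hβ ≤ -(m : ℤ) := fun m hm => by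
    have := Finset.mem_range.1 hm; omega
  set g : ℕ → (Fin 2 → ℝ) → ℂ := fun m k => E (-(m : ℤ)) (k₀, k) - E (-(m : ℤ) - 1) (k₀, k) with hg
  have hgd : ∀ m, ContDiff ℝ b (g m) := fun m => (hS1 _ _ b).sub (hS1 _ _ b)
  have hfun : (fun k => E h' (k₀, k) - ((sqDispersion k : ℝ) : ℂ)) = -fun k => (∑ m ∈ Finset.range n, g m k) := by
    funext k
    rw [Pi.neg_apply, bgm_telescope E hh₀ (k₀, k), hI]
    simp only [hg]
    ring
  unfold mixedPartial
  rw [hfun, iteratedFDeriv_neg_apply, neg_apply, norm_neg]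
  have hsum : iteratedFDeriv ℝ b (fun k => ∑ m ∈ Finset.range n, g m k) k =
      ∑ m ∈ Finset.range n, iteratedFDeriv ℝ b (g m) k := by
    rw [iteratedFDeriv_sum (𝕜 := ℝ) (f := fun m k => g m k) (u := Finset.range n) (i := b) (fun m _ => hgd m)]
    simp
  rw [hsum, sum_apply, Finset.mul_sum]
  refine (norm_sum_le _ _).trans (Finset.sum_le_sum fun m hm => ?_)
  exact norm_mixedPartial_increment_le hS (hmem m hm) hb i hk₀ k

/-- `Σ_{m<n} mγ^{-m} ≤ 2` (`γ = 4`). [folklore] -/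
private theorem sum_mul_zpow_neg_le_two (n : ℕ) : ∑ m ∈ Finset.range n, (m : ℝ) * (4 : ℝ) ^ (-(m : ℤ)) ≤ 2 := by
  have hterm : ∀ m : ℕ, (m : ℝ) * (4 : ℝ) ^ (-(m : ℤ)) ≤ (1 / 2 : ℝ) ^ m := by
    intro m
    have h4 : (0 : ℝ) < 4 ^ m := by positivity
    have h2 : (0 : ℝ) < 2 ^ m := by positivity
    rw [zpow_neg, zpow_natCast, one_div, inv_pow, mul_inv_le_iff₀ h4]
    have h42 : (2 ^ m)⁻¹ * (4 : ℝ) ^ m = 2 ^ m := by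
      rw [show (4 : ℝ) ^ m = 2 ^ m * 2 ^ m by rw [← mul_pow]; norm_num, ← mul_assoc, inv_mul_cancel₀ h2.ne', one_mul]
    rw [h42]
    exact_mod_cast (Nat.lt_two_pow_self (n := m)).le
  calc ∑ m ∈ Finset.range n, (m : ℝ) * (4 : ℝ) ^ (-(m : ℤ)) ≤ ∑ m ∈ Finset.range n, (1 / 2 : ℝ) ^ m :=
        Finset.sum_le_sum fun m _ => hterm m
    _ ≤ 2 := sum_geometric_two_le n

/-- `Σ_{m<n} mγ^{(b-2)m} ≤ n²γ^{(b-2)n}` for `b ≥ 2`. [folklore] -/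
private theorem sum_mul_zpow_le_sq_mul {b : ℕ} (hb : 2 ≤ b) (n : ℕ) :
    ∑ m ∈ Finset.range n, (m : ℝ) * (4 : ℝ) ^ ((2 - (b : ℤ)) * (-(m : ℤ))) ≤
      (n : ℝ) ^ 2 * (4 : ℝ) ^ ((2 - (b : ℤ)) * (-(n : ℤ))) := by
  have hterm : ∀ m ∈ Finset.range n, (m : ℝ) * (4 : ℝ) ^ ((2 - (b : ℤ)) * (-(m : ℤ))) ≤
      (n : ℝ) * (4 : ℝ) ^ ((2 - (b : ℤ)) * (-(n : ℤ))) := by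
    intro m hm
    have hmn := (Finset.mem_range.1 hm).le
    have hexp : (2 - (b : ℤ)) * (-(m : ℤ)) ≤ (2 - (b : ℤ)) * (-(n : ℤ)) := by nlinarith
    exact mul_le_mul (by exact_mod_cast hmn) (zpow_le_zpow_right₀ (by norm_num) hexp)
      (zpow_pos (by norm_num) _).le (Nat.cast_nonneg n)
  calc _ ≤ ∑ _m ∈ Finset.range n, (n : ℝ) * (4 : ℝ) ^ ((2 - (b : ℤ)) * (-(n : ℤ))) := Finset.sum_le_sum hterm
    _ = (n : ℝ) ^ 2 * (4 : ℝ) ^ ((2 - (b : ℤ)) * (-(n : ℤ))) := by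
        rw [Finset.sum_const, Finset.card_range, nsmul_eq_mul]; ring

/-- **(2.42), first order**: `‖∂_{k_i}(E_{h'} - E_0)(k₀, k⃗)‖ ≤ 2C₁U²` ("`≤ C₁'|U|²`").
[cite: BenfattoGiulianiMastropietro2006, §2.4 (2.42) p0009:L113] -/
theorem norm_mixedPartial_one_E_sub_le (hI : BGMInitial E) (hS : BGMSmoothness β U C hβ E) {h' : ℤ}
    (hh₁ : hβ - 1 ≤ h') (hh₀ : h' ≤ 0) (i : Fin 1 → Fin 2) {k₀ : ℝ} (hk₀ : k₀ ∈ matsubaraSet β) (k : Fin 2 → ℝ) :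
    ‖mixedPartial i (fun k => E h' (k₀, k) - ((sqDispersion k : ℝ) : ℂ)) k‖ ≤ 2 * |C 1| * U ^ 2 := by
  have h := norm_mixedPartial_E_sub_le_sum hI hS hh₁ hh₀ le_rfl i hk₀ k
  have hs : ∑ m ∈ Finset.range (-h').toNat, (m : ℝ) * (4 : ℝ) ^ ((2 - ((1 : ℕ) : ℤ)) * (-(m : ℤ))) ≤ 2 := by
    have e : ∀ m : ℕ, (2 - ((1 : ℕ) : ℤ)) * (-(m : ℤ)) = -(m : ℤ) := fun m => by push_cast; ring
    simp only [e]
    exact sum_mul_zpow_neg_le_two _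
  calc _ ≤ |C 1| * U ^ 2 * ∑ m ∈ Finset.range (-h').toNat, (m : ℝ) * (4 : ℝ) ^ ((2 - ((1 : ℕ) : ℤ)) * (-(m : ℤ))) := h
    _ ≤ |C 1| * U ^ 2 * 2 := by gcongr
    _ = 2 * |C 1| * U ^ 2 := by ring

/-- **(2.42), orders `b ≥ 2`**: `‖∂_{k_{i₁}}⋯∂_{k_{i_b}}(E_{h'} - E_0)(k₀, k⃗)‖ ≤ C_b U²h'²γ^{(2-b)h'}`
(`U²h'² ≤ c₀²`: "`≤ C₂'c₀²`" at `b = 2`, "`≤ C_n'|U|²|h|γ^{(2-n)h}`" for `n ≥ 3`).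
[cite: BenfattoGiulianiMastropietro2006, §2.4 (2.42) p0009:L114–p0010:L1] -/
theorem norm_mixedPartial_E_sub_le (hI : BGMInitial E) (hS : BGMSmoothness β U C hβ E) {h' : ℤ}
    (hh₁ : hβ - 1 ≤ h') (hh₀ : h' ≤ 0) {b : ℕ} (hb : 2 ≤ b) (i : Fin b → Fin 2) {k₀ : ℝ}
    (hk₀ : k₀ ∈ matsubaraSet β) (k : Fin 2 → ℝ) :
    ‖mixedPartial i (fun k => E h' (k₀, k) - ((sqDispersion k : ℝ) : ℂ)) k‖ ≤
      |C b| * U ^ 2 * (h' : ℝ) ^ 2 * (4 : ℝ) ^ ((2 - (b : ℤ)) * h') := by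
  have h := norm_mixedPartial_E_sub_le_sum hI hS hh₁ hh₀ (by omega) i hk₀ k
  set n := (-h').toNat with hn
  have hnz : ((n : ℕ) : ℤ) = -h' := Int.toNat_of_nonneg (by omega)
  have hnr : (n : ℝ) = -(h' : ℝ) := by exact_mod_cast hnz
  have hs := sum_mul_zpow_le_sq_mul hb n
  rw [hnz, neg_neg, hnr, neg_sq] at hs
  calc _ ≤ |C b| * U ^ 2 * ∑ m ∈ Finset.range n, (m : ℝ) * (4 : ℝ) ^ ((2 - (b : ℤ)) * (-(m : ℤ))) := h
    _ ≤ |C b| * U ^ 2 * ((h' : ℝ) ^ 2 * (4 : ℝ) ^ ((2 - (b : ℤ)) * h')) := by gcongr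
    _ = _ := by ring

end MixedPartials

/-! ### §3 Line derivatives of the dispersion slices -/

section Lines

variable {β U : ℝ} {C : ℕ → ℝ} {hβ : ℤ} {E : ℤ → ℝ × (Fin 2 → ℝ) → ℂ}

/-- The slice `k⃗ ↦ E_{h'}(k₀, k⃗)` is smooth (hypothesis (2.36), formal `L = ∞` form). [cite: BenfattoGiulianiMastropietro2006, §2.3 (2.36) footnote 1 p0008:L52] -/
theorem contDiff_slice (hS : BGMSmoothness β U C hβ E) (h' : ℤ) (k₀ : ℝ) {n : ℕ} :
    ContDiff ℝ n (fun k : Fin 2 → ℝ => E h' (k₀, k)) := hS.1 h' k₀ n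

/-- **The free part along a line**: `‖∂ₛᵇ ε₀(x⃗ + s w⃗)‖ ≤ 2|w₁|ᵇ + 2|w₂|ᵇ ≤ 2|w⃗|₁ᵇ` for `b ≥ 1` (complex-valued
form). [folklore] -/
private theorem norm_iteratedDeriv_sqDispersion_line_le (x w : Fin 2 → ℝ) (s : ℝ) {b : ℕ} (hb : 1 ≤ b) :
    ‖iteratedDeriv b (fun s : ℝ => ((sqDispersion (x + s • w) : ℝ) : ℂ)) s‖ ≤ 2 * (|w 0| + |w 1|) ^ b := by
  set r : ℝ → ℝ := fun s : ℝ => -2 * Real.cos (x 0 + s * w 0) + -2 * Real.cos (x 1 + s * w 1) + -(0 : ℝ) with hr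
  have hrs : ∀ s : ℝ, sqDispersion (x + s • w) = r s := fun s => by
    simp only [hr, sqDispersion, Pi.add_apply, Pi.smul_apply, smul_eq_mul]; ring
  have hfun : (fun s : ℝ => ((sqDispersion (x + s • w) : ℝ) : ℂ)) = fun s : ℝ => Complex.ofRealCLM (r s) := by
    funext s; rw [hrs]; rfl
  have hrd : ContDiff ℝ b r := by rw [hr]; fun_prop
  rw [hfun, norm_iteratedDeriv_ofReal_comp hrd s]
  refine (abs_iteratedDeriv_lineDispersion_le 0 x w s hb).trans ?_
  have h01 := pow_add_pow_le (abs_nonneg (w 0)) (abs_nonneg (w 1)) (by omega : b ≠ 0)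
  linarith

/-- **Line derivatives of the interacting part `E_{h'} - E_0`, every order `b ≥ 2`**:
`‖∂ₛᵇ (E_{h'} - ε₀)(k₀, x⃗ + s w⃗)‖ ≤ C_b U²h'²γ^{(2-b)h'}|w⃗|₁ᵇ` ((2.42) evaluated on `(w⃗,…,w⃗)`).
[cite: BenfattoGiulianiMastropietro2006, §2.4 (2.42) p0009:L110–p0010:L1] -/
theorem norm_iteratedDeriv_E_sub_line_le (hI : BGMInitial E) (hS : BGMSmoothness β U C hβ E) {h' : ℤ}
    (hh₁ : hβ - 1 ≤ h') (hh₀ : h' ≤ 0) {b : ℕ} (hb : 2 ≤ b) {k₀ : ℝ} (hk₀ : k₀ ∈ matsubaraSet β)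
    (x w : Fin 2 → ℝ) (s : ℝ) :
    ‖iteratedDeriv b (fun s : ℝ => E h' (k₀, x + s • w) - ((sqDispersion (x + s • w) : ℝ) : ℂ)) s‖ ≤
      |C b| * U ^ 2 * (h' : ℝ) ^ 2 * (4 : ℝ) ^ ((2 - (b : ℤ)) * h') * (|w 0| + |w 1|) ^ b := by
  set R : (Fin 2 → ℝ) → ℂ := fun k => E h' (k₀, k) - ((sqDispersion k : ℝ) : ℂ) with hR
  have hRd : ContDiff ℝ b R := (contDiff_slice hS h' k₀).sub (Complex.ofRealCLM.contDiff.comp contDiff_sqDispersion)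
  have h := Literature.Analysis.Calculus.iteratedDeriv_lineRestriction hRd x w s
  change iteratedDeriv b (fun s : ℝ => R (x + s • w)) s = _ at h
  rw [show (fun s : ℝ => E h' (k₀, x + s • w) - ((sqDispersion (x + s • w) : ℝ) : ℂ)) = fun s : ℝ => R (x + s • w)
    from rfl, h]
  exact norm_apply_const_le_of_components _ w fun i => norm_mixedPartial_E_sub_le hI hS hh₁ hh₀ hb i hk₀ (x + s • w)

/-- **Line derivatives of the interacting part, first order**: `‖∂ₛ (E_{h'} - ε₀)(k₀, x⃗ + s w⃗)‖ ≤ 2C₁U²|w⃗|₁`.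
[cite: BenfattoGiulianiMastropietro2006, §2.4 (2.42) p0009:L113] -/
theorem norm_deriv_E_sub_line_le (hI : BGMInitial E) (hS : BGMSmoothness β U C hβ E) {h' : ℤ}
    (hh₁ : hβ - 1 ≤ h') (hh₀ : h' ≤ 0) {k₀ : ℝ} (hk₀ : k₀ ∈ matsubaraSet β) (x w : Fin 2 → ℝ) (s : ℝ) :
    ‖iteratedDeriv 1 (fun s : ℝ => E h' (k₀, x + s • w) - ((sqDispersion (x + s • w) : ℝ) : ℂ)) s‖ ≤
      2 * |C 1| * U ^ 2 * (|w 0| + |w 1|) := by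
  set R : (Fin 2 → ℝ) → ℂ := fun k => E h' (k₀, k) - ((sqDispersion k : ℝ) : ℂ) with hR
  have hRd : ContDiff ℝ 1 R := (contDiff_slice hS h' k₀).sub (Complex.ofRealCLM.contDiff.comp contDiff_sqDispersion)
  have h := Literature.Analysis.Calculus.iteratedDeriv_lineRestriction hRd x w s
  change iteratedDeriv 1 (fun s : ℝ => R (x + s • w)) s = _ at h
  rw [show (fun s : ℝ => E h' (k₀, x + s • w) - ((sqDispersion (x + s • w) : ℝ) : ℂ)) = fun s : ℝ => R (x + s • w)
    from rfl, h]
  have := norm_apply_const_le_of_components (iteratedFDeriv ℝ 1 R (x + s • w)) w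
    fun i => norm_mixedPartial_one_E_sub_le hI hS hh₁ hh₀ i hk₀ (x + s • w)
  simpa using this

/-- **All-order line bounds for the dispersion slice `E_{h'}(k₀, ·)`**, `h_β - 1 ≤ h' ≤ 0`, `k₀ ∈ D_β`:
for `b ≥ 2`, `‖∂ₛᵇ E_{h'}(k₀, x⃗ + s w⃗)‖ ≤ (2 + C_b U²h'²γ^{(2-b)h'})|w⃗|₁ᵇ` — the derivatives of `ε₀` plus the
growth `γ^{(2-b)h'}` of (2.42). [cite: BenfattoGiulianiMastropietro2006, §2.4 (2.42) p0009:L110–p0010:L1] -/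
theorem norm_iteratedDeriv_slice_line_le (hI : BGMInitial E) (hS : BGMSmoothness β U C hβ E) {h' : ℤ}
    (hh₁ : hβ - 1 ≤ h') (hh₀ : h' ≤ 0) {b : ℕ} (hb : 2 ≤ b) {k₀ : ℝ} (hk₀ : k₀ ∈ matsubaraSet β)
    (x w : Fin 2 → ℝ) (s : ℝ) :
    ‖iteratedDeriv b (fun s : ℝ => E h' (k₀, x + s • w)) s‖ ≤
      (2 + |C b| * U ^ 2 * (h' : ℝ) ^ 2 * (4 : ℝ) ^ ((2 - (b : ℤ)) * h')) * (|w 0| + |w 1|) ^ b := by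
  have hε : ContDiff ℝ b (fun s : ℝ => ((sqDispersion (x + s • w) : ℝ) : ℂ)) :=
    (Complex.ofRealCLM.contDiff.comp contDiff_sqDispersion).comp (contDiff_const.add (contDiff_id.smul contDiff_const))
  have hE : ContDiff ℝ b (fun s : ℝ => E h' (k₀, x + s • w)) :=
    (contDiff_slice hS h' k₀).comp (contDiff_const.add (contDiff_id.smul contDiff_const))
  have hsplit : (fun s : ℝ => E h' (k₀, x + s • w)) = fun s : ℝ =>
      (E h' (k₀, x + s • w) - ((sqDispersion (x + s • w) : ℝ) : ℂ)) + ((sqDispersion (x + s • w) : ℝ) : ℂ) := by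
    funext s; ring
  rw [hsplit, iteratedDeriv_fun_add (hE.sub hε).contDiffAt hε.contDiffAt]
  refine (norm_add_le _ _).trans ?_
  have h1 := norm_iteratedDeriv_E_sub_line_le hI hS hh₁ hh₀ hb hk₀ x w s
  have h2 := norm_iteratedDeriv_sqDispersion_line_le x w s (by omega : 1 ≤ b)
  calc _ ≤ |C b| * U ^ 2 * (h' : ℝ) ^ 2 * (4 : ℝ) ^ ((2 - (b : ℤ)) * h') * (|w 0| + |w 1|) ^ b +
        2 * (|w 0| + |w 1|) ^ b := add_le_add h1 h2
    _ = _ := by ring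

/-- **First-order line bound for the slice**: `‖∂ₛ E_{h'}(k₀, x⃗ + s w⃗)‖ ≤ (2 + 2C₁U²)|w⃗|₁`
(`|∇ε₀·w⃗| ≤ 2|w⃗|₁`). [cite: BenfattoGiulianiMastropietro2006, §2.4 (2.42) p0009:L113] -/
theorem norm_iteratedDeriv_one_slice_line_le (hI : BGMInitial E) (hS : BGMSmoothness β U C hβ E) {h' : ℤ}
    (hh₁ : hβ - 1 ≤ h') (hh₀ : h' ≤ 0) {k₀ : ℝ} (hk₀ : k₀ ∈ matsubaraSet β) (x w : Fin 2 → ℝ) (s : ℝ) :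
    ‖iteratedDeriv 1 (fun s : ℝ => E h' (k₀, x + s • w)) s‖ ≤ (2 + 2 * |C 1| * U ^ 2) * (|w 0| + |w 1|) := by
  have hε : ContDiff ℝ 1 (fun s : ℝ => ((sqDispersion (x + s • w) : ℝ) : ℂ)) :=
    (Complex.ofRealCLM.contDiff.comp contDiff_sqDispersion).comp (contDiff_const.add (contDiff_id.smul contDiff_const))
  have hE : ContDiff ℝ 1 (fun s : ℝ => E h' (k₀, x + s • w)) :=
    (contDiff_slice hS h' k₀).comp (contDiff_const.add (contDiff_id.smul contDiff_const))
  have hsplit : (fun s : ℝ => E h' (k₀, x + s • w)) = fun s : ℝ =>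
      (E h' (k₀, x + s • w) - ((sqDispersion (x + s • w) : ℝ) : ℂ)) + ((sqDispersion (x + s • w) : ℝ) : ℂ) := by
    funext s; ring
  rw [hsplit, iteratedDeriv_fun_add (hE.sub hε).contDiffAt hε.contDiffAt]
  refine (norm_add_le _ _).trans ?_
  have h1 := norm_deriv_E_sub_line_le hI hS hh₁ hh₀ hk₀ x w s
  have h2 := norm_iteratedDeriv_sqDispersion_line_le x w s le_rfl
  rw [pow_one] at h2
  calc _ ≤ 2 * |C 1| * U ^ 2 * (|w 0| + |w 1|) + 2 * (|w 0| + |w 1|) := add_le_add h1 h2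
    _ = _ := by ring

end Lines

end Literature.MathematicalPhysics.QuantumLattice.FermiRG
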